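import Mathlib.Analysis.MellinTransform
import Mathlib.Analysis.Calculus.MeanValue
import Mathlib.Analysis.SpecialFunctions.Integrals.Basic
import Mathlib.NumberTheory.LSeries.RiemannZeta
import HarnessLib

/-!
# Mellin transforms of functions with vanishing integral: the zero at `w = 1` that cancels the pole of `ζ`

If `∫_0^∞ g = 0` then `𝓜g(w) = ∫_0^∞ g(x)(x^{w-1} − 1)dx`, and since `|x^{w-1} − 1| ≤ |w−1|·|log x|·
max(1, x^{Re w−1})` (mean value theorem for `t ↦ x^{t(w-1)}`), the Mellin transform vanishes at `w = 1` at
least to first order, with the explicit bound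

  `‖𝓜g(w)‖ ≤ |w − 1| · ∫_0^∞ |log x| max(1, x^{Re w−1}) ‖g(x)‖ dx`     (`norm_mellin_le_of_integral_eq_zero`),

so that `‖ζ(w)𝓜g(w)‖ ≤ |(w−1)ζ(w)| · ∫_0^∞ |log x| max(1, x^{Re w−1}) ‖g(x)‖ dx`
(`norm_riemannZeta_mul_mellin_le_of_integral_eq_zero`), where `(w−1)ζ(w)` extends continuously (by `1`)
across the pole (Mathlib's `riemannZeta_residue_one`).  This is the elementary mechanism by which, in
Connes' programme (Letter 2026, §6; Connes–Consani–Moscovici 2025, §7), the products `ζ(½+s)·𝓜f(s+½)` for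
test functions with `∫ f = 0` (the Hermite combination `h`, the prolate guess `h_λ`, and their difference)
stay bounded near `s = ½`; it is recorded here as a tool for the analysis of the Letter's Fact 6.4
(file `ConnesProlateGuessError.lean`).  Also: a compactly supported continuous function has an absolutely
convergent Mellin transform on `Re w > 0` (`mellinConvergent_ofReal_of_continuousOn`).  Everything is
proved; nothing here is specific to `ζ` beyond the last inequality, and nothing approaches RH.
-/

open Real Complex Set MeasureTheory Filter Topology

namespace Literature.NumberTheory.LFunctions

/-- **`|x^z − 1| ≤ |z|·|log x|·max(1, x^{Re z})`** for `x > 0`, `z ∈ ℂ` (mean value theorem applied to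
`t ↦ x^{tz} = e^{t z log x}` on `[0,1]`, with `|e^{t z log x}| = x^{t Re z} ≤ max(1, x^{Re z})`). [folklore] -/
theorem norm_cpow_sub_one_le {x : ℝ} (hx : 0 < x) (z : ℂ) :
    ‖(x : ℂ) ^ z - 1‖ ≤ ‖z‖ * |Real.log x| * max 1 (x ^ z.re) := by
  set c : ℂ := Complex.log (x : ℂ) * z with hc
  have hxz : (x : ℂ) ^ z = Complex.exp c := by
    rw [Complex.cpow_def_of_ne_zero (Complex.ofReal_ne_zero.mpr hx.ne'), hc]
  have hc' : c = ((Real.log x : ℝ) : ℂ) * z := by rw [hc, Complex.ofReal_log hx.le]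
  have hcre : c.re = Real.log x * z.re := by
    rw [hc']; simp [Complex.mul_re]
  have hcn : ‖c‖ = |Real.log x| * ‖z‖ := by
    rw [hc', norm_mul, Complex.norm_real, Real.norm_eq_abs]
  -- mean value theorem for `t ↦ exp (t c)` on `[0, 1]`
  have hderiv : ∀ t ∈ Icc (0 : ℝ) 1, HasDerivWithinAt (fun t : ℝ ↦ Complex.exp ((t : ℂ) * c))
      (Complex.exp ((t : ℂ) * c) * c) (Icc 0 1) t := by
    intro t _
    have h : HasDerivAt (fun u : ℂ ↦ Complex.exp (u * c)) (Complex.exp ((t : ℂ) * c) * c) (t : ℂ) :=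
      ((hasDerivAt_mul_const c).cexp)
    exact h.comp_ofReal.hasDerivWithinAt
  have hbound : ∀ t ∈ Ico (0 : ℝ) 1,
      ‖Complex.exp ((t : ℂ) * c) * c‖ ≤ ‖c‖ * max 1 (Real.exp c.re) := by
    intro t ht
    rw [norm_mul, Complex.norm_exp, mul_comm]
    have htre : ((t : ℂ) * c).re = t * c.re := by simp [Complex.mul_re]
    rw [htre]
    gcongr
    rcases le_or_gt 0 c.re with hpos | hneg
    · calc Real.exp (t * c.re) ≤ Real.exp c.re := by
            apply Real.exp_le_exp.mpr
            nlinarith [ht.1, ht.2]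
        _ ≤ max 1 (Real.exp c.re) := le_max_right _ _
    · calc Real.exp (t * c.re) ≤ 1 := by
            apply Real.exp_le_one_iff.mpr
            nlinarith [ht.1, ht.2]
        _ ≤ max 1 (Real.exp c.re) := le_max_left _ _
  have key := norm_image_sub_le_of_norm_deriv_le_segment_01' hderiv hbound
  simp only [Complex.ofReal_one, one_mul, Complex.ofReal_zero, zero_mul, Complex.exp_zero] at key
  rw [hxz]
  calc ‖Complex.exp c - 1‖ ≤ ‖c‖ * max 1 (Real.exp c.re) := key
    _ = ‖z‖ * |Real.log x| * max 1 (x ^ z.re) := by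
        rw [hcn, hcre, Real.rpow_def_of_pos hx]; ring

/-- **`𝓜g(w) = ∫_0^∞ (x^{w-1} − 1) g(x) dx` when `∫_0^∞ g = 0`.** [folklore] -/
theorem mellin_eq_integral_cpow_sub_one_smul {f : ℝ → ℂ} {w : ℂ} (hf : MellinConvergent f w)
    (hfi : IntegrableOn f (Ioi 0)) (h0 : ∫ x in Ioi 0, f x = 0) :
    mellin f w = ∫ x : ℝ in Ioi 0, ((x : ℂ) ^ (w - 1) - 1) • f x := by
  rw [mellin, ← sub_zero (∫ x : ℝ in Ioi 0, (x : ℂ) ^ (w - 1) • f x), ← h0, ← integral_sub hf hfi]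
  refine setIntegral_congr_fun measurableSet_Ioi fun x _ ↦ ?_
  simp only [sub_smul, one_smul]

/-- **First-order vanishing at `w = 1`.**  If `g` is integrable on `(0,∞)` with `∫_0^∞ g = 0`, has an
absolutely convergent Mellin transform at `w`, and `|log x|·max(1,x^{Re w−1})·‖g(x)‖` is integrable, then
`‖𝓜g(w)‖ ≤ |w−1| · ∫_0^∞ |log x| max(1, x^{Re w−1}) ‖g(x)‖ dx`. [folklore] -/
theorem norm_mellin_le_of_integral_eq_zero {f : ℝ → ℂ} {w : ℂ} (hf : MellinConvergent f w)
    (hfi : IntegrableOn f (Ioi 0)) (h0 : ∫ x in Ioi 0, f x = 0)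
    (hW : IntegrableOn (fun x : ℝ ↦ |Real.log x| * max 1 (x ^ (w.re - 1)) * ‖f x‖) (Ioi 0)) :
    ‖mellin f w‖ ≤ ‖w - 1‖ * ∫ x in Ioi 0, |Real.log x| * max 1 (x ^ (w.re - 1)) * ‖f x‖ := by
  rw [mellin_eq_integral_cpow_sub_one_smul hf hfi h0, ← MeasureTheory.integral_const_mul]
  refine norm_integral_le_of_norm_le (hW.const_mul _) ?_
  refine ae_restrict_of_forall_mem measurableSet_Ioi fun x hx ↦ ?_
  rw [norm_smul]
  have h := norm_cpow_sub_one_le hx (w - 1)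
  rw [Complex.sub_re, Complex.one_re] at h
  calc ‖(x : ℂ) ^ (w - 1) - 1‖ * ‖f x‖
      ≤ (‖w - 1‖ * |Real.log x| * max 1 (x ^ (w.re - 1))) * ‖f x‖ := by gcongr
    _ = ‖w - 1‖ * (|Real.log x| * max 1 (x ^ (w.re - 1)) * ‖f x‖) := by ring

/-- **The pole of `ζ` is cancelled.**  Under the same hypotheses,
`‖ζ(w)·𝓜g(w)‖ ≤ |(w−1)ζ(w)| · ∫_0^∞ |log x| max(1, x^{Re w−1}) ‖g(x)‖ dx`; the factor `(w−1)ζ(w)` is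
bounded near `w = 1` (it tends to `1`: Mathlib `riemannZeta_residue_one`) and continuous elsewhere on
`Re w > 0`. [folklore] -/
theorem norm_riemannZeta_mul_mellin_le_of_integral_eq_zero {f : ℝ → ℂ} {w : ℂ}
    (hf : MellinConvergent f w) (hfi : IntegrableOn f (Ioi 0)) (h0 : ∫ x in Ioi 0, f x = 0)
    (hW : IntegrableOn (fun x : ℝ ↦ |Real.log x| * max 1 (x ^ (w.re - 1)) * ‖f x‖) (Ioi 0)) :
    ‖riemannZeta w * mellin f w‖ ≤
      ‖(w - 1) * riemannZeta w‖ * ∫ x in Ioi 0, |Real.log x| * max 1 (x ^ (w.re - 1)) * ‖f x‖ := by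
  have h := norm_mellin_le_of_integral_eq_zero hf hfi h0 hW
  have hI : 0 ≤ ∫ x in Ioi 0, |Real.log x| * max 1 (x ^ (w.re - 1)) * ‖f x‖ :=
    setIntegral_nonneg measurableSet_Ioi fun x _ ↦ by positivity
  calc ‖riemannZeta w * mellin f w‖ = ‖riemannZeta w‖ * ‖mellin f w‖ := norm_mul _ _
    _ ≤ ‖riemannZeta w‖ * (‖w - 1‖ * ∫ x in Ioi 0, |Real.log x| * max 1 (x ^ (w.re - 1)) * ‖f x‖) := by
        gcongr
    _ = ‖(w - 1) * riemannZeta w‖ *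
          ∫ x in Ioi 0, |Real.log x| * max 1 (x ^ (w.re - 1)) * ‖f x‖ := by
        rw [norm_mul]; ring

/-! ### Mellin convergence for compactly supported continuous functions -/

/-- A function continuous on `[0, A]` and vanishing on `(A, ∞)` has an absolutely convergent Mellin
transform at every `w` with `Re w > 0` (`|x^{w-1} f(x)| ≤ M x^{Re w−1}` on `(0,A]`). [folklore] -/
theorem mellinConvergent_ofReal_of_continuousOn {f : ℝ → ℝ} {A : ℝ} (hA : 0 < A)
    (hcont : ContinuousOn f (Icc 0 A)) (hsupp : ∀ x, A < x → f x = 0) {w : ℂ} (hw : 0 < w.re) :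
    MellinConvergent (fun x ↦ (f x : ℂ)) w := by
  obtain ⟨M, hM⟩ : ∃ M, ∀ t ∈ Icc 0 A, ‖f t‖ ≤ M :=
    isCompact_Icc.exists_bound_of_continuousOn hcont
  have hσ : -1 < w.re - 1 := by linarith
  rw [MellinConvergent]
  have hU : Ioi (0 : ℝ) = Ioc 0 A ∪ Ioi A := (Ioc_union_Ioi_eq_Ioi hA.le).symm
  rw [hU]
  refine IntegrableOn.union ?_ ?_
  · -- on `(0, A]`: dominated by `M x^{Re w - 1}`
    have hmeas : AEStronglyMeasurable (fun x : ℝ ↦ (x : ℂ) ^ (w - 1) • (f x : ℂ))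
        (volume.restrict (Ioc 0 A)) := by
      refine ContinuousOn.aestronglyMeasurable (fun x hx ↦ ?_) measurableSet_Ioc
      have h1 : ContinuousWithinAt (fun x : ℝ ↦ (x : ℂ) ^ (w - 1)) (Ioc 0 A) x :=
        (continuousAt_ofReal_cpow_const _ _ (Or.inr hx.1.ne')).continuousWithinAt
      have h2 : ContinuousWithinAt (fun x : ℝ ↦ (f x : ℂ)) (Ioc 0 A) x :=
        Complex.continuous_ofReal.continuousAt.comp_continuousWithinAt
          (hcont.mono Ioc_subset_Icc_self x hx)
      exact h1.smul h2
    have hdom : IntegrableOn (fun x : ℝ ↦ M * x ^ (w.re - 1)) (Ioc 0 A) := by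
      have h := (intervalIntegral.intervalIntegrable_rpow' (a := 0) (b := A) hσ)
      rw [intervalIntegrable_iff_integrableOn_Ioc_of_le hA.le] at h
      exact h.const_mul _
    refine Integrable.mono' hdom hmeas ?_
    refine ae_restrict_of_forall_mem measurableSet_Ioc fun x hx ↦ ?_
    rw [norm_smul, Complex.norm_cpow_eq_rpow_re_of_pos hx.1, Complex.sub_re, Complex.one_re,
      Complex.norm_real, mul_comm]
    exact mul_le_mul_of_nonneg_right (hM x ⟨hx.1.le, hx.2⟩) (Real.rpow_nonneg hx.1.le _)
  · -- on `(A, ∞)`: identically zero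
    refine integrableOn_zero.congr_fun (fun x hx ↦ ?_) measurableSet_Ioi
    simp [hsupp x hx]

end Literature.NumberTheory.LFunctions
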